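import Literature.MathematicalPhysics.QuantumFieldTheory.Balaban1983to89.B9Thm31GpAgmonDecayNearFlatCubeZd
import Literature.MathematicalPhysics.QuantumFieldTheory.Balaban1983to89.B9Thm31NearFlatCoerciveCubeZd

/-!
# `Balaban1983to89.B9Thm31GpAgmonDecayNearFlatTowerZd` — [Balaban1985BackgroundPropagators] Thm 3.1 (3.42) p. 397 with Thm 3.11 p. 416 («U = e^{iηA} with A small»),
# THE NEAR-FLAT COARSE AGMON BOUND OF `B9Thm31GpAgmonDecayNearFlatCubeZd` IN THE DISCHARGEABLE HYPOTHESIS SHAPES: (T) the averaged-transporter closeness asked only on the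
# TOWER PAIRS `(blockMap L w, w)` that `Q′_j(U₀)` reads (dag-n06-w4 g5's `B9Eq324NearFlatFormComparisonZdTowerPairs.formE_deltaPrimeADom_one_le_near_flat'`), and (N) the
# OPERATOR-NORM readings `‖U₀(b) − 1‖ ≤ θ′η`, `‖Ū₀ⁱ(Γ_{blockMap L w, w}) − 1‖ ≤ ε′_i` through the fibre-norm comparison `|a|_τ ≤ C_u‖a‖`, `‖a‖ ≤ C_l|a|_τ` (dag-n06-w4 g5's
# `B9Thm31NearFlatCoerciveCubeZd.fnorm_conjR_sub_le_of_cmp`): for print-scaled weights, `m₈ = min{8, a_lo}`, `ηLᵐ ≤ 1`, `4(dθ² + κ_T) ≤ m₈` (resp.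
# `4(2C_uC_l)²(dθ′² + κ′_T) ≤ m₈`), `0 ≤ κ ≤ 1` with `κ(48d + 120a_hi) ≤ m₈`, all `x, y ∈ □₀`:
# ★★★ `|(G′(U₀)δ_y w)(x)|_τ ≤ (8∕m₈)·(ηLᵐ)²·e^{−κL^{−m}|x−y|_∞}·|w|_τ` — member-uniform

statement-level skeleton of published theorems with citation tags; proofs where landed; nothing here is a claim about the
Yang–Mills mass gap

`[Balaban1985BackgroundPropagators]` ("B9", CMP **99** (1985) 389–434) Thm 3.1 p. 397, Thm 3.11 p. 416; `[Balaban1985Averaging]` (122)–(126) p. 36 (the averaged transporters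
near `1`).  THIS FILE re-runs `B9Thm31GpAgmonDecayNearFlatCubeZd.fnorm_GpZd_single_le_exp_nearFlat_cubeMember` VERBATIM with dag-n06-w4 g5's tower-pair comparison in place of
the all-pairs one (p637960's `formE_deltaPrimeADom_one_le_near_flat'`: the hypothesis `hTε` only on the pairs `(blockMap L w, w)`, which their `B9Thm31NearFlatTransportersZd`
discharges from the background's own smallness), and adds the operator-norm edition through their `fnorm_conjR_sub_le_of_cmp` — so that the member-uniform near-flat decay
of `G′(U₀)` at the `ℤᵈ` cube members is stated on hypotheses the class road of N06 actually produces.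

CITATION HEADER (lean-in-tree rule).  Cell `pub-ymgap` (YM Track A, HUMAN RULING D-0062 ∕ D-0149 width push), DAG node N06 = [B9], width seat
`pub-ymgap-dag-n06-w2` (g5), CLAIM-11.  Inputs BY NAME: this seat's FILES 4–7 (`fnorm_GpZd_single_le_exp_coarse`, `sum_mass_le_formE_deltaPrimeADom_one_cubeMember`,
`sum_ite_eq_of_fullBlockGeometry`, `levelCoercive_of_comparison`), dag-n06-w4 g5's `formE_deltaPrimeADom_one_le_near_flat'`, `fnorm_conjR_sub_le_of_cmp`, `fullBlockGeometry_cubeMember`,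
`cover_cubeLamS`.  Nothing restated.

WHAT IS PROVED (kernel, 0 sorry, 0 def; no `instance`, no `notation`).
* §1 ★★★ `fnorm_GpZd_single_le_exp_nearFlat_cubeMember_tower` — as FILE 7's theorem with `hTε : ∀ i < m, ∀ w b, |R(Ū₀ⁱ(blockMap L w, w))b − b|_τ ≤ ε_i|b|_τ` (TOWER PAIRS).
* §2 ★★★ `fnorm_GpZd_single_le_exp_nearFlat_cubeMember_of_norm` — OPERATOR-NORM READINGS: `‖U₀(x,μ) − 1‖ ≤ θ′η`, `‖Ū₀ⁱ(Γ_{blockMap L w,w}) − 1‖ ≤ ε′_i`, fibre-norm comparison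
  constants `C_u, C_l ≥ 0`, `a_j(Lᵈ)^{−j}(Σ_{i<j}ε′_i)² ≤ κ′_T`, `4(2C_uC_l)²(dθ′² + κ′_T) ≤ m₈` ⟹ the same bound.

HONEST SCOPE.  Near-flat letters displayed (operator norm at scale `η`; their discharge on the (3.35) class from `pdev` smallness is dag-n06-w4's `B9Thm31NearFlatTransportersZd` ∕
CLAIM-9 road); single coarsest-scale rate; `L²`-derived pointwise bound.  Count-neutral; N05 ∕ N06 NOT discharged; K1⁹ `stmt-QuantumFields-27364` NOT closed; one finite `𝕋⁴`
programme at fixed `ε`, Bałaban as printed; R4 closes only the conditional finite-`𝕋⁴` rung `BalabanLadder.UV` — nothing continuum ∕ ℝ⁴ ∕ OS ∕ mass gap ∕ Clay.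
Unit `pub-ymgap-dag-n06-w2` (g5), 2026-08-28.
-/

noncomputable section

open scoped BigOperators

namespace Literature.MathematicalPhysics.QuantumFieldTheory.Balaban1983to89.B9Thm31GpAgmonDecayNearFlatTowerZd

open Literature.MathematicalPhysics.QuantumLattice (blockMap)
open B7Prop1Explicit (e)
open B7Eq78Linearization (conjR)
open B7Prop2Explicit (unitaryUnits)
open B8Eq119TwistedAxial (bgT)
open B8Eq131CubesAdmissible (cubeFam)
open B8CubeMemberZd (cubeLamS)
open B8LeafModelZd (ZdIdx)
open B8Eq191FlatLettersCubeMember (cubeLamS_finite)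
open B9Thm311PosDefOpenZd (cubeMember_Ω0_finite)
open B9Eq319QQStarDiagonalZd (FullBlockGeometry fullBlockGeometry_cubeMember)
open B9Eq321LandauProjectionZd (suppSub formE formE_apply)
open B9Eq324DeltaPrimeAZd (single restrictSite deltaPrimeADom GpZd)
open B9Eq325QprimeSingleSiteZd (blockMapIter)
open B9Eq342CombesThomasFormZd
open B9Thm31FlatPoincareCoerciveZd (cover_cubeLamS)
open B9Thm31GpAgmonDecayCoarseZd (fnorm_GpZd_single_le_exp_coarse)
open B9Thm31LevelPoincareCoerciveZd (sum_mass_le_formE_deltaPrimeADom_one_cubeMember)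
open B9Thm31GpAgmonDecayFlatCubeZd (sum_ite_eq_of_fullBlockGeometry)
open B9Eq324NearFlatFormComparisonZdTowerPairs (formE_deltaPrimeADom_one_le_near_flat')
open B9Thm31GpAgmonDecayNearFlatCubeZd (levelCoercive_of_comparison)
open B9Thm31NearFlatCoerciveCubeZd (fnorm_conjR_sub_le_of_cmp)
open LatticeNorms (linfDist)

export B7Prop1Explicit (Site)

variable {d : ℕ} {𝔸 : Type*} [CStarAlgebra 𝔸]


/-! ## §1  ★★★ The near-flat bound at a cube member, tower-pair transporter hypothesis -/

section NearFlat

variable (L : ℕ) (τ : 𝔸 →ₗ[ℂ] ℂ) [FiniteDimensional ℝ 𝔸] (hτp : ∀ a : 𝔸, a ≠ 0 → 0 < (τ (star a * a)).re)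

/-- ★★★ **[B9] THM 3.1's (3.42), n = 0 SHAPE, FOR `G′(U₀)` OF EVERY CUBE MEMBER AT A NEAR-FLAT BACKGROUND — TOWER-PAIR TRANSPORTER HYPOTHESIS.**  `2 ≤ L ≤ ρ`,
`m ≤ i.k`, `ηLᵐ ≤ 1`; `τ` tracial Hermitian faithful, `𝔸` finite-dimensional nontrivial; `U₀` unitary with `|R(U₀(x,μ))a − a|_τ ≤ θη|a|_τ`; averaged transporters unitary and
`ε_i`-close ON THE TOWER PAIRS (`|R(Ū₀ⁱ(blockMap L w, w))a − a|_τ ≤ ε_i|a|_τ`) with `a_j(Lᵈ)^{−j}(Σ_{i<j}ε_i)² ≤ κ_T`; print-scaled weights `a_lo(Lᵈ)ʲ(ηLʲ)⁻² ≤ a_j ≤ a_hi(Lᵈ)ʲ(ηLʲ)⁻²` (`j ≤ m`, `0 < a_lo`);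
`m₈ := min{8, a_lo}`, `4(dθ² + κ_T) ≤ m₈`; `0 ≤ κ ≤ 1`, `κ(48d + 120a_hi) ≤ m₈`.  THEN for `x, y ∈ □₀`:
`|(G′(U₀)δ_y w)(x)|_τ ≤ (8∕m₈)·(ηLᵐ)²·e^{−κL^{−m}|x−y|_∞}·|w|_τ` — constants depending on `d, a_lo, a_hi` only.
[cite: Balaban1985BackgroundPropagators, Thm 3.1 p.397, (3.42) p.397, Thm 3.11 p.416, (3.86) p.407, (3.24) p.394; Balaban1985RegularSpaces, (1.131) p.99; Agmon1982, Thm 1.5 p.19] -/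
theorem fnorm_GpZd_single_le_exp_nearFlat_cubeMember_tower [Nontrivial 𝔸] (hd : 0 < d) (hL : 2 ≤ L) (hτt : ∀ a b : 𝔸, τ (a * b) = τ (b * a))
    (hτs : ∀ a : 𝔸, τ (star a) = starRingEnd ℂ (τ a)) (i : ZdIdx d L) {ac : Site d} {Mc ρc : ℕ} (hΩ : i.Ω = cubeFam false L ac Mc ρc i.k)
    (hρc : L ≤ ρc) {m : ℕ} (hm : m ≤ i.k) (hηm : i.η * (L : ℝ) ^ m ≤ 1) {a : ℕ → ℝ} (ha : ∀ j, 0 ≤ a j) {a_lo a_hi : ℝ} (halo : 0 < a_lo)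
    (hlo : ∀ j ∈ Finset.range (m + 1), a_lo * ((L : ℝ) ^ d) ^ j * ((i.η * (L : ℝ) ^ j) ^ 2)⁻¹ ≤ a j)
    (hhi : ∀ j ∈ Finset.range (m + 1), a j ≤ a_hi * ((L : ℝ) ^ d) ^ j * ((i.η * (L : ℝ) ^ j) ^ 2)⁻¹)
    {U₀ : Site d → Fin d → 𝔸ˣ} (hU : ∀ (x : Site d) (κ' : Fin d), U₀ x κ' ∈ unitaryUnits 𝔸) {θ : ℝ}
    (hR : ∀ (x : Site d) (μ : Fin d) (b : 𝔸), fnorm τ (conjR (U₀ x μ) b - b) ≤ θ * i.η * fnorm τ b)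
    {ε : ℕ → ℝ} (hε : ∀ i', 0 ≤ ε i') (hT : ∀ i', i' < m → ∀ z y : Site d, bgT L U₀ i' z y ∈ unitaryUnits 𝔸)
    (hTε : ∀ i', i' < m → ∀ (w' : Site d) (b : 𝔸), fnorm τ (conjR (bgT L U₀ i' (blockMap L w') w') b - b) ≤ ε i' * fnorm τ b)
    {κT : ℝ} (hκT0 : 0 ≤ κT) (hκT : ∀ j ∈ Finset.range (m + 1), a j * ((((L : ℝ) ^ d) ^ j)⁻¹ * (∑ i' ∈ Finset.range j, ε i') ^ 2) ≤ κT)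
    (hsmall : 4 * (d * θ ^ 2 + κT) ≤ min 8 a_lo)
    {κ : ℝ} (hκ0 : 0 ≤ κ) (hκ1 : κ ≤ 1) (hκ : κ * (48 * d + 120 * a_hi) ≤ min 8 a_lo)
    {x y : Site d} (hx : x ∈ (cubeMember_Ω0_finite i hΩ).toFinset) (hy : y ∈ (cubeMember_Ω0_finite i hΩ).toFinset) (w : 𝔸) :
    fnorm τ ((GpZd L U₀ i.η τ hτp m a (fun j => (cubeLamS_finite L ac Mc ρc i.k m j).toFinset)
        (cubeMember_Ω0_finite i hΩ).toFinset hd i.hη.ne' hτt hτs hU ha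
        (restrictSite (cubeMember_Ω0_finite i hΩ).toFinset (single y w)) : Site d → 𝔸) x) ≤
      8 / min 8 a_lo * (i.η * (L : ℝ) ^ m) ^ 2 * Real.exp (-(κ * (((L : ℝ) ^ m)⁻¹ * ((linfDist x y : ℕ) : ℝ)))) * fnorm τ w := by
  classical
  haveI : NeZero L := ⟨by omega⟩
  have hL1 : 1 ≤ L := le_trans one_le_two hL
  have hL0 : (0 : ℝ) < L := by exact_mod_cast (lt_of_lt_of_le zero_lt_two hL)
  set S := (cubeMember_Ω0_finite i hΩ).toFinset with hS
  set Λ : ℕ → Finset (Site d) := fun j => (cubeLamS_finite L ac Mc ρc i.k m j).toFinset with hΛ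
  set η : ℝ := i.η with hη
  have hη0 : 0 < η := i.hη
  set m₈ : ℝ := min 8 a_lo with hm₈
  have hm₈0 : 0 < m₈ := lt_min (by norm_num) halo
  have hm₈8 : m₈ ≤ 8 := min_le_left _ _
  have hm₈lo : m₈ ≤ a_lo := min_le_right _ _
  -- geometry of the member
  have hG : FullBlockGeometry L m Λ S := fullBlockGeometry_cubeMember i hΩ hρc hm
  have hsS : ∀ z, z ∈ S ↔ z ∈ cubeFam false L ac Mc ρc i.k 0 := fun z => by rw [hS, Set.Finite.mem_toFinset, hΩ]
  have hΛmem : ∀ j y', y' ∈ Λ j ↔ y' ∈ cubeLamS L ac Mc ρc i.k m j := fun j y' => Set.Finite.mem_toFinset _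
  have hcov : ∀ z ∈ S, ∃ j ∈ Finset.range (m + 1), blockMapIter L j z ∈ Λ j := by
    intro z hz
    obtain ⟨j, hj, hmem⟩ := cover_cubeLamS hL1 ac Mc ρc ((hsS z).1 hz) (m := m)
    exact ⟨j, hj, (hΛmem j _).2 hmem⟩
  -- the site mass `m₈(ηL^{j(z)})⁻²`
  set M : Site d → ℝ := fun z => ∑ j ∈ Finset.range (m + 1), (if blockMapIter L j z ∈ Λ j then m₈ * ((η * (L : ℝ) ^ j) ^ 2)⁻¹ else 0) with hM
  have hMval : ∀ j₀ ∈ Finset.range (m + 1), ∀ z : Site d, blockMapIter L j₀ z ∈ Λ j₀ → M z = m₈ * ((η * (L : ℝ) ^ j₀) ^ 2)⁻¹ :=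
    fun j₀ hj₀ z hz => sum_ite_eq_of_fullBlockGeometry hG hj₀ hz _
  -- the floor `μ₀ = m₈(ηLᵐ)⁻² ≤ M` on `□₀`, and `m₈ ≤ μ₀` (`ηLᵐ ≤ 1`)
  set μ₀ : ℝ := m₈ * ((η * (L : ℝ) ^ m) ^ 2)⁻¹ with hμ₀
  have hμ₀pos : 0 < μ₀ := by positivity
  have hfloor : ∀ z ∈ S, μ₀ ≤ M z := by
    intro z hz
    obtain ⟨j, hj, hzj⟩ := hcov z hz
    rw [hMval j hj z hzj]
    have hjm : j ≤ m := Nat.lt_succ_iff.1 (Finset.mem_range.1 hj)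
    have hLj : (L : ℝ) ^ j ≤ (L : ℝ) ^ m := pow_le_pow_right₀ (by exact_mod_cast hL1) hjm
    have hLj0 : 0 < η * (L : ℝ) ^ j := by positivity
    show m₈ * ((η * (L : ℝ) ^ m) ^ 2)⁻¹ ≤ m₈ * ((η * (L : ℝ) ^ j) ^ 2)⁻¹
    gcongr
  have hm₈μ₀ : m₈ ≤ μ₀ := by
    rw [hμ₀]
    have h1 : (η * (L : ℝ) ^ m) ^ 2 ≤ 1 := by
      have h0 : 0 ≤ η * (L : ℝ) ^ m := by positivity
      nlinarith
    have h2 : 1 ≤ ((η * (L : ℝ) ^ m) ^ 2)⁻¹ := one_le_inv_iff₀.2 ⟨by positivity, h1⟩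
    nlinarith
  have hM0 : ∀ z ∈ S, 0 ≤ M z := fun z hz => hμ₀pos.le.trans (hfloor z hz)
  have hMpos : ∀ z ∈ S, 0 < M z := fun z hz => hμ₀pos.trans_le (hfloor z hz)
  -- the level-weighted FLAT coercivity (FILE 5)
  have hflat : ∀ Φ : suppSub (𝔸 := 𝔸) S, ∑ z ∈ S, M z * fnorm τ ((Φ : Site d → 𝔸) z) ^ 2 ≤
      formE τ S Φ (deltaPrimeADom L (1 : Site d → Fin d → 𝔸ˣ) η τ hτp m a Λ S Φ) := by
    intro Φ
    refine sum_mass_le_formE_deltaPrimeADom_one_cubeMember τ hτp hτt hτs hη0 ha i hΩ hρc hm (fun j hj y' hy' z hz => ?_) Φ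
    rw [hMval j hj z (hz ▸ hy')]
    refine le_min ?_ ?_
    · exact mul_le_mul_of_nonneg_right hm₈8 (by positivity)
    · have h := hlo j hj
      have hLd : 0 < ((L : ℝ) ^ d) ^ j := by positivity
      have key : m₈ * ((η * (L : ℝ) ^ j) ^ 2)⁻¹ * ((L : ℝ) ^ d) ^ j ≤ a j :=
        calc m₈ * ((η * (L : ℝ) ^ j) ^ 2)⁻¹ * ((L : ℝ) ^ d) ^ j ≤ a_lo * ((η * (L : ℝ) ^ j) ^ 2)⁻¹ * ((L : ℝ) ^ d) ^ j := by gcongr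
          _ = a_lo * ((L : ℝ) ^ d) ^ j * ((η * (L : ℝ) ^ j) ^ 2)⁻¹ := by ring
          _ ≤ a j := h
      calc m₈ * ((η * (L : ℝ) ^ j) ^ 2)⁻¹ = (m₈ * ((η * (L : ℝ) ^ j) ^ 2)⁻¹ * ((L : ℝ) ^ d) ^ j) * (((L : ℝ) ^ d) ^ j)⁻¹ := by
            rw [mul_assoc (m₈ * _), mul_inv_cancel₀ hLd.ne', mul_one]
        _ ≤ a j * (((L : ℝ) ^ d) ^ j)⁻¹ := mul_le_mul_of_nonneg_right key (by positivity)
        _ = a j * (((L : ℝ) ^ d)⁻¹) ^ j := by rw [inv_pow]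
  -- the near-flat comparison (dag-n06-w4 g5) and the transfer (§1): `(1∕4)Σ M|Φ|² ≤ ⟨Φ, Δ′_a(U₀)Φ⟩`
  have hdisj : ∀ j ∈ Finset.range (m + 1), ∀ y' ∈ Λ j, ∀ i' ∈ Finset.range (m + 1), ∀ y'' ∈ Λ i', (i', y'') ≠ (j, y') →
      ∀ z : Site d, blockMapIter L j z = y' → blockMapIter L i' z ≠ y'' := fun j hj y' hy' => (hG j hj y' hy').2
  have hcmp : ∀ Φ : suppSub (𝔸 := 𝔸) S, formE τ S Φ (deltaPrimeADom L (1 : Site d → Fin d → 𝔸ˣ) η τ hτp m a Λ S Φ) ≤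
      2 * formE τ S Φ (deltaPrimeADom L U₀ η τ hτp m a Λ S Φ) + 2 * (d * θ ^ 2 + κT) * formE τ S Φ Φ := fun Φ =>
    formE_deltaPrimeADom_one_le_near_flat' τ hτp hτt hτs hη0 hU hR m ha Λ hdisj hε hT hTε hκT0 hκT Φ
  have hE0 : 0 ≤ d * θ ^ 2 + κT := by positivity
  have hco : ∀ Φ : suppSub (𝔸 := 𝔸) S, 1 / 4 * ∑ z ∈ S, M z * fnorm τ ((Φ : Site d → 𝔸) z) ^ 2 ≤
      formE τ S Φ (deltaPrimeADom L U₀ η τ hτp m a Λ S Φ) := fun Φ =>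
    levelCoercive_of_comparison hτp hμ₀pos hE0 (hsmall.trans hm₈μ₀) hfloor hflat hcmp Φ
  -- the two scaling slots with `B = 1∕m₈`, `A = a_hi∕m₈`
  have hB : ∀ z ∈ S, (η⁻¹) ^ 2 * (((L : ℝ) ^ m)⁻¹) ^ 2 ≤ m₈⁻¹ * M z := by
    intro z hz
    have h := hfloor z hz
    rw [hμ₀] at h
    calc (η⁻¹) ^ 2 * (((L : ℝ) ^ m)⁻¹) ^ 2 = m₈⁻¹ * (m₈ * ((η * (L : ℝ) ^ m) ^ 2)⁻¹) := by
          rw [← mul_assoc, inv_mul_cancel₀ hm₈0.ne', one_mul, mul_pow, mul_inv, inv_pow, inv_pow]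
      _ ≤ m₈⁻¹ * M z := mul_le_mul_of_nonneg_left h (inv_nonneg.2 hm₈0.le)
  have hA : ∀ z ∈ S, ∑ j ∈ Finset.range (m + 1), (if blockMapIter L j z ∈ Λ j then a j * (((L : ℝ) ^ d)⁻¹) ^ j else 0) ≤ a_hi * m₈⁻¹ * M z := by
    intro z hz
    obtain ⟨j, hj, hzj⟩ := hcov z hz
    rw [sum_ite_eq_of_fullBlockGeometry hG hj hzj, hMval j hj z hzj]
    have h := hhi j hj
    have hLd : 0 < ((L : ℝ) ^ d) ^ j := by positivity
    rw [inv_pow, show a_hi * m₈⁻¹ * (m₈ * ((η * (L : ℝ) ^ j) ^ 2)⁻¹) = a_hi * ((η * (L : ℝ) ^ j) ^ 2)⁻¹ by field_simp]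
    rw [← div_eq_mul_inv (a j), div_le_iff₀ hLd]
    calc a j ≤ a_hi * ((L : ℝ) ^ d) ^ j * ((η * (L : ℝ) ^ j) ^ 2)⁻¹ := h
      _ = a_hi * ((η * (L : ℝ) ^ j) ^ 2)⁻¹ * ((L : ℝ) ^ d) ^ j := by ring
  -- the window with `θ_A = 1∕2`, `c₀ = 1∕4`
  have hahi0 : 0 ≤ a_hi := by
    have h0 := hlo 0 (Finset.mem_range.2 (Nat.succ_pos m))
    have h1 := hhi 0 (Finset.mem_range.2 (Nat.succ_pos m))
    have hpos : 0 < ((L : ℝ) ^ d) ^ 0 * ((η * (L : ℝ) ^ 0) ^ 2)⁻¹ := by positivity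
    have : a_lo * ((L : ℝ) ^ d) ^ 0 * ((η * (L : ℝ) ^ 0) ^ 2)⁻¹ ≤ a_hi * ((L : ℝ) ^ d) ^ 0 * ((η * (L : ℝ) ^ 0) ^ 2)⁻¹ := h0.trans h1
    rw [mul_assoc, mul_assoc] at this
    nlinarith [le_of_mul_le_mul_right this hpos]
  have hκ' : κ * (6 * d * m₈⁻¹ + 15 * (a_hi * m₈⁻¹)) ≤ 1 / 2 * (1 / 4) := by
    have h1 : κ * (6 * d * m₈⁻¹ + 15 * (a_hi * m₈⁻¹)) = (κ * (48 * d + 120 * a_hi)) / (8 * m₈) := by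
      field_simp
      ring
    rw [h1, div_le_iff₀ (by positivity), show (1 : ℝ) / 2 * (1 / 4) * (8 * m₈) = m₈ by ring]
    exact hκ
  have hmain := fnorm_GpZd_single_le_exp_coarse L U₀ η τ hτp m a Λ S hd i.hη.ne' hL1 hτt hτs hU hT ha
    (by norm_num : (0 : ℝ) < 1 / 4) (by norm_num : (0 : ℝ) ≤ 1 / 2) (by norm_num : (1 : ℝ) / 2 < 1) hM0 hco hκ0 hκ1 hκ' hB hA hy w
    (hMpos x hx) (hMpos y hy)
  refine hmain.trans ?_
  -- `√(M_xM_y) ≥ μ₀` and `1∕((1∕2)(1∕4)μ₀) = (8∕m₈)(ηLᵐ)²`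
  have hsqrt : μ₀ ≤ Real.sqrt (M x * M y) := by
    rw [Real.le_sqrt hμ₀pos.le (mul_pos (hMpos x hx) (hMpos y hy)).le, sq]
    exact mul_le_mul (hfloor x hx) (hfloor y hy) hμ₀pos.le (hMpos x hx).le
  have hE := Real.exp_pos (-(κ * (((L : ℝ) ^ m)⁻¹ * ((linfDist x y : ℕ) : ℝ))))
  have hw0 := fnorm_nonneg τ w
  have hden : (1 : ℝ) / ((1 - 1 / 2) * (1 / 4) * Real.sqrt (M x * M y)) ≤ 1 / ((1 - 1 / 2) * (1 / 4) * μ₀) := by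
    apply one_div_le_one_div_of_le (by positivity)
    exact mul_le_mul_of_nonneg_left hsqrt (by norm_num)
  have hμ₀inv : (1 : ℝ) / ((1 - 1 / 2) * (1 / 4) * μ₀) = 8 / m₈ * (η * (L : ℝ) ^ m) ^ 2 := by
    rw [hμ₀]
    have hpow : (0 : ℝ) < (η * (L : ℝ) ^ m) ^ 2 := by positivity
    field_simp
    ring
  calc Real.exp (-(κ * (((L : ℝ) ^ m)⁻¹ * ((linfDist x y : ℕ) : ℝ)))) / ((1 - 1 / 2) * (1 / 4) * Real.sqrt (M x * M y)) * fnorm τ w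
      = (1 / ((1 - 1 / 2) * (1 / 4) * Real.sqrt (M x * M y))) * Real.exp (-(κ * (((L : ℝ) ^ m)⁻¹ * ((linfDist x y : ℕ) : ℝ)))) * fnorm τ w := by ring
    _ ≤ (1 / ((1 - 1 / 2) * (1 / 4) * μ₀)) * Real.exp (-(κ * (((L : ℝ) ^ m)⁻¹ * ((linfDist x y : ℕ) : ℝ)))) * fnorm τ w := by gcongr
    _ = 8 / min 8 a_lo * (i.η * (L : ℝ) ^ m) ^ 2 * Real.exp (-(κ * (((L : ℝ) ^ m)⁻¹ * ((linfDist x y : ℕ) : ℝ)))) * fnorm τ w := by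
        rw [hμ₀inv]


/-! ## §2  ★★★ Operator-norm readings -/

/-- ★★★ **THE SAME WITH OPERATOR-NORM CLOSENESS** (`‖U₀(x,μ) − 1‖ ≤ θ′η` on all bonds, `‖Ū₀ⁱ(Γ_{blockMap L w, w}) − 1‖ ≤ ε′_i` on the tower pairs, fibre-norm comparison
`|a|_τ ≤ C_u‖a‖`, `‖a‖ ≤ C_l|a|_τ`, `a_j(Lᵈ)^{−j}(Σ_{i<j}ε′_i)² ≤ κ′_T`, `4(2C_uC_l)²(dθ′² + κ′_T) ≤ m₈`): for `0 ≤ κ ≤ 1` with `κ(48d + 120a_hi) ≤ m₈` and `x, y ∈ □₀`,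
`|(G′(U₀)δ_y w)(x)|_τ ≤ (8∕m₈)·(ηLᵐ)²·e^{−κL^{−m}|x−y|_∞}·|w|_τ`.
[cite: Balaban1985BackgroundPropagators, Thm 3.1 p.397, (3.42) p.397, Thm 3.11 p.416; Balaban1985Averaging, (122)–(126) p.36; Agmon1982, Thm 1.5 p.19] -/
theorem fnorm_GpZd_single_le_exp_nearFlat_cubeMember_of_norm [Nontrivial 𝔸] (hd : 0 < d) (hL : 2 ≤ L) (hτt : ∀ a b : 𝔸, τ (a * b) = τ (b * a))
    (hτs : ∀ a : 𝔸, τ (star a) = starRingEnd ℂ (τ a)) {Cu Cl : ℝ} (hCu : ∀ a : 𝔸, fnorm τ a ≤ Cu * ‖a‖) (hCl : ∀ a : 𝔸, ‖a‖ ≤ Cl * fnorm τ a)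
    (hCu0 : 0 ≤ Cu) (hCl0 : 0 ≤ Cl) (i : ZdIdx d L) {ac : Site d} {Mc ρc : ℕ} (hΩ : i.Ω = cubeFam false L ac Mc ρc i.k)
    (hρc : L ≤ ρc) {m : ℕ} (hm : m ≤ i.k) (hηm : i.η * (L : ℝ) ^ m ≤ 1) {a : ℕ → ℝ} (ha : ∀ j, 0 ≤ a j) {a_lo a_hi : ℝ} (halo : 0 < a_lo)
    (hlo : ∀ j ∈ Finset.range (m + 1), a_lo * ((L : ℝ) ^ d) ^ j * ((i.η * (L : ℝ) ^ j) ^ 2)⁻¹ ≤ a j)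
    (hhi : ∀ j ∈ Finset.range (m + 1), a j ≤ a_hi * ((L : ℝ) ^ d) ^ j * ((i.η * (L : ℝ) ^ j) ^ 2)⁻¹)
    {U₀ : Site d → Fin d → 𝔸ˣ} (hU : ∀ (x : Site d) (κ' : Fin d), U₀ x κ' ∈ unitaryUnits 𝔸) {θ' : ℝ}
    (hR : ∀ (x : Site d) (μ : Fin d), ‖((U₀ x μ : 𝔸ˣ) : 𝔸) - 1‖ ≤ θ' * i.η)
    {ε' : ℕ → ℝ} (hε' : ∀ i', 0 ≤ ε' i') (hT : ∀ i', i' < m → ∀ z y : Site d, bgT L U₀ i' z y ∈ unitaryUnits 𝔸)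
    (hTε : ∀ i', i' < m → ∀ (w' : Site d), ‖((bgT L U₀ i' (blockMap L w') w' : 𝔸ˣ) : 𝔸) - 1‖ ≤ ε' i')
    {κT' : ℝ} (hκT0 : 0 ≤ κT') (hκT : ∀ j ∈ Finset.range (m + 1), a j * ((((L : ℝ) ^ d) ^ j)⁻¹ * (∑ i' ∈ Finset.range j, ε' i') ^ 2) ≤ κT')
    (hsmall : 4 * ((2 * Cu * Cl) ^ 2 * (d * θ' ^ 2 + κT')) ≤ min 8 a_lo)
    {κ : ℝ} (hκ0 : 0 ≤ κ) (hκ1 : κ ≤ 1) (hκ : κ * (48 * d + 120 * a_hi) ≤ min 8 a_lo)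
    {x y : Site d} (hx : x ∈ (cubeMember_Ω0_finite i hΩ).toFinset) (hy : y ∈ (cubeMember_Ω0_finite i hΩ).toFinset) (w : 𝔸) :
    fnorm τ ((GpZd L U₀ i.η τ hτp m a (fun j => (cubeLamS_finite L ac Mc ρc i.k m j).toFinset)
        (cubeMember_Ω0_finite i hΩ).toFinset hd i.hη.ne' hτt hτs hU ha
        (restrictSite (cubeMember_Ω0_finite i hΩ).toFinset (single y w)) : Site d → 𝔸) x) ≤
      8 / min 8 a_lo * (i.η * (L : ℝ) ^ m) ^ 2 * Real.exp (-(κ * (((L : ℝ) ^ m)⁻¹ * ((linfDist x y : ℕ) : ℝ)))) * fnorm τ w := by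
  set C : ℝ := 2 * Cu * Cl with hC
  have hC0 : 0 ≤ C := by positivity
  -- the τ-size hypotheses with `θ := Cθ′`, `ε := Cε′`, `κ_T := C²κ′_T` (dag-n06-w4 g5's conversions)
  have hRτ : ∀ (x : Site d) (μ : Fin d) (b : 𝔸), fnorm τ (conjR (U₀ x μ) b - b) ≤ (C * θ') * i.η * fnorm τ b := by
    intro x μ b
    refine (fnorm_conjR_sub_le_of_cmp τ hCu hCl hCu0 (hU x μ) b).trans ?_
    rw [← hC]
    have hb := fnorm_nonneg τ b
    calc C * ‖((U₀ x μ : 𝔸ˣ) : 𝔸) - 1‖ * fnorm τ b ≤ C * (θ' * i.η) * fnorm τ b :=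
          mul_le_mul_of_nonneg_right (mul_le_mul_of_nonneg_left (hR x μ) hC0) hb
      _ = (C * θ') * i.η * fnorm τ b := by ring
  have hTτ : ∀ i', i' < m → ∀ (w' : Site d) (b : 𝔸), fnorm τ (conjR (bgT L U₀ i' (blockMap L w') w') b - b) ≤ (C * ε' i') * fnorm τ b := by
    intro i' hi' w' b
    refine (fnorm_conjR_sub_le_of_cmp τ hCu hCl hCu0 (hT i' hi' _ _) b).trans ?_
    rw [← hC]
    exact mul_le_mul_of_nonneg_right (mul_le_mul_of_nonneg_left (hTε i' hi' w') hC0) (fnorm_nonneg τ b)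
  have hκτ : ∀ j ∈ Finset.range (m + 1), a j * ((((L : ℝ) ^ d) ^ j)⁻¹ * (∑ i' ∈ Finset.range j, C * ε' i') ^ 2) ≤ C ^ 2 * κT' := by
    intro j hj
    rw [← Finset.mul_sum, mul_pow]
    calc a j * ((((L : ℝ) ^ d) ^ j)⁻¹ * (C ^ 2 * (∑ i' ∈ Finset.range j, ε' i') ^ 2))
        = C ^ 2 * (a j * ((((L : ℝ) ^ d) ^ j)⁻¹ * (∑ i' ∈ Finset.range j, ε' i') ^ 2)) := by ring
      _ ≤ C ^ 2 * κT' := mul_le_mul_of_nonneg_left (hκT j hj) (sq_nonneg C)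
  have hsmall' : 4 * (d * (C * θ') ^ 2 + C ^ 2 * κT') ≤ min 8 a_lo := by
    have : 4 * (d * (C * θ') ^ 2 + C ^ 2 * κT') = 4 * ((2 * Cu * Cl) ^ 2 * (d * θ' ^ 2 + κT')) := by rw [hC]; ring
    rw [this]; exact hsmall
  exact fnorm_GpZd_single_le_exp_nearFlat_cubeMember_tower L τ hτp hd hL hτt hτs i hΩ hρc hm hηm ha halo hlo hhi hU hRτ
    (fun i' => mul_nonneg hC0 (hε' i')) hT hTτ (by positivity) hκτ hsmall' hκ0 hκ1 hκ hx hy w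

end NearFlat

end Literature.MathematicalPhysics.QuantumFieldTheory.Balaban1983to89.B9Thm31GpAgmonDecayNearFlatTowerZd

end
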